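import Summits.Ventures.Crystal3D.Theorems.StickyWulffConstantCoaxialWallLawWordRigidityMulti
import HarnessLib

/-!
# Word rigidity ACROSS root families, letterwise: equal slot dozens force equal letters up to sign

HONEST FRAMING. Part of the venture `Summits/Ventures/Crystal3D` (cell `crystal3d-full`), helper for the crux
`CoaxialWallLaw` (stmt-Ventures-19481) of `route-Ventures-StickyWulffConstant`, REGISTERED line `WallLedgerF`
(planner cf-p1), open stub `stub_coaxialTwoSlabAdhesion` (general fillings).  Rung credit only; F-C1 not moved.
Brick (B1′) of memo HOME/wall-19481-p2/F-NEXT-SPEC.md §S1 (19481-p2 g4), the enabling lemma of the TWO-PLATE count of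
twin pairs: `…WordRigidityMulti.foldl_reflect_eq_of_glued_mapsTo` (B1) proves that two menu chains with the same slot dozen
have the same length and the same frame MAP; its induction in fact peels the two chains letter by letter, the deepest
letters being equal or antipodal at every step.  This file records that stronger, LETTERWISE conclusion:

* `foldl_reflect_letters_of_glued_mapsTo` — menu chains `α, α′` whose glued mirror chain `α ++ α′.reverse` maps the slots
  into the slots agree letter by letter up to sign (`List.Forall₂ (μ′ = μ ∨ μ′ = −μ)`).
* `word_letters_of_image_eq_of_chain` — two menu-chain words with the same slot dozen agree letterwise up to sign;
  `word_deepest_of_image_eq_of_chain` — in particular their DEEPEST letters (the first mirrors applied) are equal or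
  antipodal.  Use (memo §S1, LEMMA X″): a bottom-plate word of an in-plane root `r` has a deepest letter OBLIQUE to `r`
  (`⟪r, μ⟫ = √(2/3)`, well-formedness), a top-plate word written in the bottom system has the co-axial normal `ν₀ ⟂ r` as
  its deepest letter, so the two can never present the same slot dozen at a ball — the equal-image cases of LEMMA X
  disappear for bottom-versus-top states of the same root.

WHAT THIS IS NOT: not LEMMA X″ itself, not the two-plate count; F-C1 not moved.
-/

noncomputable section

namespace Summit.Ventures.Crystal3D.Theorems

open Summit.Ventures.Crystal3D Finset
open scoped InnerProductSpace

section Multi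

variable {F : List (EuclideanSpace ℝ (Fin 3)) → (EuclideanSpace ℝ (Fin 3) ≃ₗᵢ[ℝ] EuclideanSpace ℝ (Fin 3))}

/-- **Letterwise cross-family rigidity, core.**  Two menu chains whose glued mirror chain `α ++ α′.reverse` maps the
slots into the slots agree letter by letter up to sign.  See the module docstring. -/
theorem foldl_reflect_letters_of_glued_mapsTo :
    ∀ (α α' : List (EuclideanSpace ℝ (Fin 3))),
      (∀ μ ∈ α, ‖μ‖ = 1 ∧
        ∀ w ∈ fccSlots, ⟪w, μ⟫_ℝ = 0 ∨ ⟪w, μ⟫_ℝ = Real.sqrt (2 / 3) ∨ ⟪w, μ⟫_ℝ = -Real.sqrt (2 / 3)) →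
      (∀ μ ∈ α', ‖μ‖ = 1 ∧
        ∀ w ∈ fccSlots, ⟪w, μ⟫_ℝ = 0 ∨ ⟪w, μ⟫_ℝ = Real.sqrt (2 / 3) ∨ ⟪w, μ⟫_ℝ = -Real.sqrt (2 / 3)) →
      List.IsChain (fun μ μ' => ⟪μ, μ'⟫_ℝ = 1 / 3 ∨ ⟪μ, μ'⟫_ℝ = -1 / 3) α →
      List.IsChain (fun μ μ' => ⟪μ, μ'⟫_ℝ = 1 / 3 ∨ ⟪μ, μ'⟫_ℝ = -1 / 3) α' →
      (∀ w ∈ fccSlots,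
        (α ++ α'.reverse).foldl (fun (y : EuclideanSpace ℝ (Fin 3)) μ => y - (2 * ⟪y, μ⟫_ℝ) • μ) w ∈ fccSlots) →
      List.Forall₂ (fun μ μ' => μ' = μ ∨ μ' = -μ) α α' := by
  intro α
  induction α using List.reverseRecOn with
  | nil =>
    intro α' _ hα' _ hch' hmaps
    rcases List.eq_nil_or_concat' α' with rfl | ⟨l', a', rfl⟩
    · exact List.Forall₂.nil
    · exfalso
      refine foldl_reflect_slots_false (l' ++ [a']).reverse (by simp) ?_ ?_ ?_
      · intro μ hμ; exact hα' μ (List.mem_reverse.1 hμ)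
      · rw [List.isChain_reverse]
        exact hch'.imp fun a b h => by rw [real_inner_comm]; exact h
      · intro w hw
        simpa using hmaps w hw
  | append_singleton l a ih =>
    intro α' hα hα' hch hch' hmaps
    have ha1 : ‖a‖ = 1 := (hα a (by simp)).1
    have ham := (hα a (by simp)).2
    have hl : ∀ μ ∈ l, ‖μ‖ = 1 ∧
        ∀ w ∈ fccSlots, ⟪w, μ⟫_ℝ = 0 ∨ ⟪w, μ⟫_ℝ = Real.sqrt (2 / 3) ∨ ⟪w, μ⟫_ℝ = -Real.sqrt (2 / 3) :=
      fun μ hμ => hα μ (List.mem_append_left _ hμ)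
    have hchl : List.IsChain (fun μ μ' => ⟪μ, μ'⟫_ℝ = 1 / 3 ∨ ⟪μ, μ'⟫_ℝ = -1 / 3) l := hch.left_of_append
    rcases List.eq_nil_or_concat' α' with rfl | ⟨l', a', rfl⟩
    · -- `α' = []`: the glued list is `α` itself, a nonempty chain
      exfalso
      refine foldl_reflect_slots_false (l ++ [a]) (by simp) hα hch ?_
      intro w hw
      simpa using hmaps w hw
    · have ha'1 : ‖a'‖ = 1 := (hα' a' (by simp)).1
      have ha'm := (hα' a' (by simp)).2
      have hl' : ∀ μ ∈ l', ‖μ‖ = 1 ∧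
          ∀ w ∈ fccSlots, ⟪w, μ⟫_ℝ = 0 ∨ ⟪w, μ⟫_ℝ = Real.sqrt (2 / 3) ∨ ⟪w, μ⟫_ℝ = -Real.sqrt (2 / 3) :=
        fun μ hμ => hα' μ (List.mem_append_left _ hμ)
      have hchl' : List.IsChain (fun μ μ' => ⟪μ, μ'⟫_ℝ = 1 / 3 ∨ ⟪μ, μ'⟫_ℝ = -1 / 3) l' := hch'.left_of_append
      -- the glued list is `(l ++ [a]) ++ (a' :: l'.reverse)`
      have hrev : (l' ++ [a']).reverse = a' :: l'.reverse := by simp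
      by_cases hsign : a' = a ∨ a' = -a
      · -- the two deepest mirrors cancel: induction
        have hcancel : ∀ z : EuclideanSpace ℝ (Fin 3),
            (z - (2 * ⟪z, a⟫_ℝ) • a) - (2 * ⟪z - (2 * ⟪z, a⟫_ℝ) • a, a'⟫_ℝ) • a' = z := by
          intro z
          rcases hsign with rfl | rfl
          · exact reflect_reflect_unit ha1 z
          · rw [reflect_neg_eq]; exact reflect_reflect_unit ha1 z
        have hmaps' : ∀ w ∈ fccSlots,
            (l ++ l'.reverse).foldl (fun (y : EuclideanSpace ℝ (Fin 3)) μ => y - (2 * ⟪y, μ⟫_ℝ) • μ) w ∈ fccSlots := by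
          intro w hw
          have h1 := hmaps w hw
          rw [hrev, List.foldl_append, List.foldl_cons, foldl_reflect_concat, hcancel] at h1
          rw [List.foldl_append]; exact h1
        exact List.rel_append (ih l' hl hl' hchl hchl' hmaps') (List.Forall₂.cons hsign List.Forall₂.nil)
      · -- distinct, non-antipodal deepest letters: the glued list is a nonempty menu chain
        exfalso
        obtain ⟨hne1, hne2⟩ := not_or.1 hsign
        have hjunction : ⟪a, a'⟫_ℝ = 1 / 3 ∨ ⟪a, a'⟫_ℝ = -1 / 3 :=
          menuNormals_chain_of_ne_of_ne_neg ha1 ha'1 ham ha'm (Ne.symm hne1) hne2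
        refine foldl_reflect_slots_false ((l ++ [a]) ++ (l' ++ [a']).reverse) (by simp) ?_ ?_ hmaps
        · intro μ hμ
          rcases List.mem_append.1 hμ with h | h
          · exact hα μ h
          · exact hα' μ (List.mem_reverse.1 h)
        · rw [List.isChain_append]
          refine ⟨hch, ?_, ?_⟩
          · rw [List.isChain_reverse]
            exact hch'.imp fun a b h => by rw [real_inner_comm]; exact h
          · intro x hx y hy
            rw [hrev, List.head?_cons, Option.mem_some_iff] at hy
            rw [List.getLast?_concat, Option.mem_some_iff] at hx
            rw [← hx, ← hy]
            exact hjunction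

/-- **Letterwise cross-family word rigidity.**  Two menu-chain words with the same slot dozen agree letter by letter up
to sign.  See the module docstring. -/
theorem word_letters_of_image_eq_of_chain (hFc : ∀ μ κ, F (μ :: κ) = ((ℝ ∙ μ)ᗮ.reflection).trans (F κ))
    {κ κ' : List (EuclideanSpace ℝ (Fin 3))}
    (hκ : ∀ μ ∈ κ, ‖μ‖ = 1 ∧
      ∀ w ∈ fccSlots, ⟪w, μ⟫_ℝ = 0 ∨ ⟪w, μ⟫_ℝ = Real.sqrt (2 / 3) ∨ ⟪w, μ⟫_ℝ = -Real.sqrt (2 / 3))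
    (hκ' : ∀ μ ∈ κ', ‖μ‖ = 1 ∧
      ∀ w ∈ fccSlots, ⟪w, μ⟫_ℝ = 0 ∨ ⟪w, μ⟫_ℝ = Real.sqrt (2 / 3) ∨ ⟪w, μ⟫_ℝ = -Real.sqrt (2 / 3))
    (hch : List.IsChain (fun μ μ' => ⟪μ, μ'⟫_ℝ = 1 / 3 ∨ ⟪μ, μ'⟫_ℝ = -1 / 3) κ)
    (hch' : List.IsChain (fun μ μ' => ⟪μ, μ'⟫_ℝ = 1 / 3 ∨ ⟪μ, μ'⟫_ℝ = -1 / 3) κ')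
    (himg : (F κ : EuclideanSpace ℝ (Fin 3) → EuclideanSpace ℝ (Fin 3)) '' ↑fccSlots =
      (F κ' : EuclideanSpace ℝ (Fin 3) → EuclideanSpace ℝ (Fin 3)) '' ↑fccSlots) :
    List.Forall₂ (fun μ μ' => μ' = μ ∨ μ' = -μ) κ κ' := by
  have hκu : ∀ μ ∈ κ, ‖μ‖ = 1 := fun μ hμ => (hκ μ hμ).1
  have hκ'u : ∀ μ ∈ κ', ‖μ‖ = 1 := fun μ hμ => (hκ' μ hμ).1
  have hFκ : ∀ x, F κ x = F [] (κ.foldl (fun (y : EuclideanSpace ℝ (Fin 3)) μ => y - (2 * ⟪y, μ⟫_ℝ) • μ) x) := by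
    intro x
    have := word_F_append_apply hFc κ hκu [] x
    rwa [List.append_nil] at this
  have hFκ' : ∀ x, F κ' x = F [] (κ'.foldl (fun (y : EuclideanSpace ℝ (Fin 3)) μ => y - (2 * ⟪y, μ⟫_ℝ) • μ) x) := by
    intro x
    have := word_F_append_apply hFc κ' hκ'u [] x
    rwa [List.append_nil] at this
  have hmaps : ∀ w ∈ fccSlots,
      (κ ++ κ'.reverse).foldl (fun (y : EuclideanSpace ℝ (Fin 3)) μ => y - (2 * ⟪y, μ⟫_ℝ) • μ) w ∈ fccSlots := by
    intro w hw
    have hmem : (F κ : EuclideanSpace ℝ (Fin 3) → EuclideanSpace ℝ (Fin 3)) w ∈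
        (F κ' : EuclideanSpace ℝ (Fin 3) → EuclideanSpace ℝ (Fin 3)) '' ↑fccSlots := by
      rw [← himg]; exact Set.mem_image_of_mem _ (Finset.mem_coe.2 hw)
    obtain ⟨w', hw', heq⟩ := hmem
    rw [Finset.mem_coe] at hw'
    have heq' : κ'.foldl (fun (y : EuclideanSpace ℝ (Fin 3)) μ => y - (2 * ⟪y, μ⟫_ℝ) • μ) w' =
        κ.foldl (fun (y : EuclideanSpace ℝ (Fin 3)) μ => y - (2 * ⟪y, μ⟫_ℝ) • μ) w := by
      apply (F []).injective
      rw [← hFκ, ← hFκ']; exact heq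
    have key := foldl_reflect_reverse_foldl κ' hκ'u w'
    rw [heq', ← List.foldl_append] at key
    rw [key]; exact hw'
  exact foldl_reflect_letters_of_glued_mapsTo κ κ' hκ hκ' hch hch' hmaps

/-- **The deepest letters of two menu-chain words with the same slot dozen are equal or antipodal**, and one word is
empty iff the other is.  See the module docstring. -/
theorem word_deepest_of_image_eq_of_chain (hFc : ∀ μ κ, F (μ :: κ) = ((ℝ ∙ μ)ᗮ.reflection).trans (F κ))
    {κ κ' : List (EuclideanSpace ℝ (Fin 3))}
    (hκ : ∀ μ ∈ κ, ‖μ‖ = 1 ∧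
      ∀ w ∈ fccSlots, ⟪w, μ⟫_ℝ = 0 ∨ ⟪w, μ⟫_ℝ = Real.sqrt (2 / 3) ∨ ⟪w, μ⟫_ℝ = -Real.sqrt (2 / 3))
    (hκ' : ∀ μ ∈ κ', ‖μ‖ = 1 ∧
      ∀ w ∈ fccSlots, ⟪w, μ⟫_ℝ = 0 ∨ ⟪w, μ⟫_ℝ = Real.sqrt (2 / 3) ∨ ⟪w, μ⟫_ℝ = -Real.sqrt (2 / 3))
    (hch : List.IsChain (fun μ μ' => ⟪μ, μ'⟫_ℝ = 1 / 3 ∨ ⟪μ, μ'⟫_ℝ = -1 / 3) κ)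
    (hch' : List.IsChain (fun μ μ' => ⟪μ, μ'⟫_ℝ = 1 / 3 ∨ ⟪μ, μ'⟫_ℝ = -1 / 3) κ')
    (himg : (F κ : EuclideanSpace ℝ (Fin 3) → EuclideanSpace ℝ (Fin 3)) '' ↑fccSlots =
      (F κ' : EuclideanSpace ℝ (Fin 3) → EuclideanSpace ℝ (Fin 3)) '' ↑fccSlots) :
    (κ = [] ↔ κ' = []) ∧
      ∀ (l : List (EuclideanSpace ℝ (Fin 3))) (a : EuclideanSpace ℝ (Fin 3)), κ = l ++ [a] →
        ∃ (l' : List (EuclideanSpace ℝ (Fin 3))) (a' : EuclideanSpace ℝ (Fin 3)), κ' = l' ++ [a'] ∧ (a' = a ∨ a' = -a) := by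
  have h := word_letters_of_image_eq_of_chain hFc hκ hκ' hch hch' himg
  refine ⟨?_, ?_⟩
  · constructor
    · intro h0; rw [h0] at h; exact List.forall₂_nil_left_iff.1 h
    · intro h0; rw [h0] at h; exact List.forall₂_nil_right_iff.1 h
  · intro l a hla
    rw [hla] at h
    have h' := List.forall₂_reverse_iff.2 h
    have hrev : (l ++ [a]).reverse = a :: l.reverse := by simp
    rw [hrev] at h'
    obtain ⟨b, u', hab, -, hu⟩ := List.forall₂_cons_left_iff.1 h'
    refine ⟨u'.reverse, b, ?_, hab⟩
    rw [← List.reverse_reverse κ', hu, List.reverse_cons]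

end Multi

end Summit.Ventures.Crystal3D.Theorems

end
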